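import Summits.ResolutionOfSingularities.ResolutionOfSingularities.Theorems.FrobeniusLadderFInjectiveMacaulayficationPencilPointRecipes
import Summits.ResolutionOfSingularities.ResolutionOfSingularities.Theorems.FrobeniusLadderFInjectiveMacaulayficationRsopPositionMonomials
import Summits.ResolutionOfSingularities.ResolutionOfSingularities.Theorems.FrobeniusLadderFInjectiveMacaulayficationChartPointParameters
import Summits.ResolutionOfSingularities.ResolutionOfSingularities.Theorems.FrobeniusLadderFInjectiveMacaulayficationBPBinomialTransversal
import HarnessLib

/-!
# SOUNDNESS OF THE EXIT TAGS AT A POINT OF A CHART: from the tag conditions on `(M₁, M₂, r, s)|Z` to the six inputs of ✓ `PencilStalkOverPoint.fullCl_stalk_of_pair_germ_over`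
# (BED Ω₁ GLOBAL PATCH, F6 v2 — the per-point dispatcher; crux `FInjectiveMacaulayfication` stmt-ResolutionOfSingularities-15315, chain w45a; seat res-L1-w45a-stub-3 g15)

[OURS · L1 W4.5a] Support file (`--supports stmt-ResolutionOfSingularities-15315 --as helper`); theorems only; GENERIC (any `n`, any `θ`, abstract local ring `B ← k[y]`); no named fact;
NOT a statement of any manuscript; nothing of the crux is proved. AI-written (AI review is weaker than expert review).

SETTING. `B` regular local of characteristic `p` with algebraically closed residue field and `dim B = n − 1`, `φ : k[y₀..y_{n−1}] → B` with `φ θ = 0` and `𝔭_c·B = 𝔪_B` (the stalk of the chart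
`V(θ)` at the `k`-point `c`; ✓ `ChartPointLocalRing`); `Z = {i : cᵢ = 0}`; the pencil pair `u = φ(y^{M₁})`, `v = φ(y^{M₂}(y^r − y^s))` with `M₁ ⊥ M₂`, `r ⊥ s`, `M₁|Z ≠ 0`.
* §1 bookkeeping: units `φ(yᵢ)` (`i ∉ Z`), `φ(g)` for `g(c) ≠ 0`; `φ(y^E) = (∏_{i∈Z} φ(yᵢ)^{Eᵢ})·unit`; the sorted letter list `Zl` of `Z`; transport of `∀ i ∈ Z` / `∃ i ∈ Z` conditions to positions.
* §2 the regular systems of parameters `Zl.map z ++ t` (from an Ishii letter `l ∉ Z`, ✓ `ofList_erase_eq_maximalIdeal`) and `Zl.map z ++ (φ w :: t)` (from a nonzero `2×2` minor over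
  `l, i₀ ∉ Z`, ✓ `ofList_swap_eq_maximalIdeal`), by permutation (✓ `ofList_eq_of_perm`).
* §3 ★★★ `tag_soundness` — under the tag conditions (tag 1: `M₂|Z ≤ 1`; tag 2: `M₁|Z ≤ 1`; tag 3: both `≤ 2`, `p ≠ 2`; tag 4: deep, `M₁|Z ≤ 1` + the two side letters; tag 5: deep,
  `(M₂+r)|Z ≤ 1` + the witness letter), an Ishii letter, and — on T1 orbits at points with `w(c) = 0` — a nonzero minor over two non-orbit letters: EITHER `v` is a unit, OR `u, v` are
  non-zero-divisors with `u ∣ rv → u ∣ r`, `v ∣ ru → v ∣ r` and BOTH pencil charts `B[X]/(uX − v)`, `B[X]/(vX − u)` are `FullCl p` at every prime over `𝔪_B`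
  (✓ `PencilPointRecipes.recipe_two_monomials` / `recipe_deep` on the r.s.o.p. of §2, exponents moved by ✓ `RsopPositionMonomials`).
[cite: Fedder1983, Thm. 1.12; Matsumura1987, Thm. 14.2, Thm. 17.4; IshiiSingularities2018, Lemma 4.4.24]
-/

set_option linter.dupNamespace false

noncomputable section

namespace Summit.ResolutionOfSingularities.ResolutionOfSingularities.Theorems.FInjectiveMacaulayfication.ChartPointSoundness

open IsLocalRing MvPolynomial Literature.RingTheory.TightClosure Literature.AlgebraicGeometry.Resolution
open Summit.ResolutionOfSingularities.ResolutionOfSingularities.Theorems.FInjectiveMacaulayfication SliceableCentre ChartPointParameters RsopPositionMonomials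

variable {k : Type} [Field k] {n : ℕ} (θ : MvPolynomial (Fin n) k) (c : Fin n → k)
  {B : Type} [CommRing B] [IsLocalRing B] (φ : MvPolynomial (Fin n) k →+* B)
  (hφ : (Ideal.span (Set.range fun i : Fin n => (X i : MvPolynomial (Fin n) k) - C (c i))).map φ = maximalIdeal B)
  (Z : Finset (Fin n)) (hZ : ∀ i, c i = 0 ↔ i ∈ Z)

/-! ## §1 Bookkeeping -/

include hφ in
/-- `φ g` is a unit when `g(c) ≠ 0`. [plumbing] -/
theorem isUnit_map_of_eval_ne_zero (g : MvPolynomial (Fin n) k) (hg : eval c g ≠ 0) : IsUnit (φ g) := by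
  have hmem : φ (g - C (eval c g)) ∈ maximalIdeal B :=
    map_mem_maximalIdeal c φ hφ _ (by rw [map_sub, eval_C, sub_self])
  by_contra hu
  have hg' : φ g ∈ maximalIdeal B := (mem_maximalIdeal _).mpr hu
  have : φ (C (eval c g)) ∈ maximalIdeal B := by
    have := Submodule.sub_mem _ hg' hmem
    rwa [map_sub, sub_sub_cancel] at this
  exact (mem_maximalIdeal _).mp this (isUnit_map_C φ _ hg)

include hφ hZ in
/-- `φ yᵢ` is a unit for `i ∉ Z`. [plumbing] -/
theorem isUnit_map_X (i : Fin n) (hi : i ∉ Z) : IsUnit (φ (X i)) :=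
  isUnit_map_of_eval_ne_zero c φ hφ (X i) (by rw [eval_X]; exact fun h => hi ((hZ i).mp h))

omit [IsLocalRing B] in
/-- `φ(y^E) = ∏ᵢ φ(yᵢ)^{Eᵢ}`. [plumbing] -/
theorem map_monomial_eq_prod (E : Fin n →₀ ℕ) : φ (monomial E (1 : k)) = ∏ i : Fin n, φ (X i) ^ E i := by
  rw [monomial_eq, C_1, one_mul, Finsupp.prod_fintype _ _ (fun i => by simp), map_prod]
  simp only [map_pow]

include hZ in
omit [IsLocalRing B] in
/-- Splitting `∏ᵢ φ(yᵢ)^{Eᵢ}` into the orbit letters (written with `zᵢ = φ(yᵢ − cᵢ) = φ yᵢ`) and a product over the unit letters. [plumbing] -/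
theorem prod_eq_prod_sort_mul (E : Fin n →₀ ℕ) (z : Fin n → B) (hz : ∀ i, z i = φ (X i - C (c i))) :
    (∏ i : Fin n, φ (X i) ^ E i) = (∏ i ∈ (Z.sort (· ≤ ·)).toFinset, z i ^ E i) * ∏ i ∈ Zᶜ, φ (X i) ^ E i := by
  rw [Finset.sort_toFinset, ← Finset.prod_mul_prod_compl Z]
  congr 1
  refine Finset.prod_congr rfl fun i hi => ?_
  rw [hz i, (hZ i).mpr hi, C_0, sub_zero]

include hφ hZ in
/-- The product over the unit letters is a unit. [plumbing] -/
theorem isUnit_prod_compl (E : Fin n →₀ ℕ) : IsUnit (∏ i ∈ Zᶜ, φ (X i) ^ E i) :=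
  IsUnit.prod_iff.mpr (fun i hi => (isUnit_map_X c φ hφ Z hZ i (Finset.mem_compl.mp hi)).pow _)

include hφ hZ in
/-- `φ(y^E)` is a unit when `E` vanishes on `Z`. [plumbing] -/
theorem isUnit_map_monomial (E : Fin n →₀ ℕ) (hE : ∀ i ∈ Z, E i = 0) : IsUnit (φ (monomial E (1 : k))) := by
  rw [map_monomial_eq_prod]
  refine IsUnit.prod_iff.mpr fun i _ => ?_
  by_cases hi : i ∈ Z
  · rw [hE i hi, pow_zero]; exact isUnit_one
  · exact (isUnit_map_X c φ hφ Z hZ i hi).pow _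

include hZ in
/-- A monomial vanishes at `c` iff it has a letter in `Z`. [plumbing] -/
theorem eval_monomial_eq_zero_iff (E : Fin n →₀ ℕ) : eval c (monomial E (1 : k)) = 0 ↔ ∃ i ∈ Z, E i ≠ 0 := by
  constructor
  · intro h
    by_contra hne
    push Not at hne
    exact ((BPBinomialTransversal.eval_monomial_ne_zero_iff Z c hZ E).mpr hne) h
  · rintro ⟨i, hi, hE⟩
    exact NewtonChartLemma.eval_monomial_eq_zero_of_exists Z c hZ E 1 ⟨i, hi, hE⟩

/-- Members of the sorted list of `Z` lie in `Z`. [plumbing] -/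
theorem sort_getElem_mem (q : ℕ) (h : q < (Z.sort (· ≤ ·)).length) : (Z.sort (· ≤ ·))[q] ∈ Z :=
  (Finset.mem_sort _).mp (List.getElem_mem h)

/-- Transport of a `∀ i ∈ Z` bound to the position exponent. [plumbing] -/
theorem pos_le_of_forall (M : Fin n → ℕ) (N : ℕ) (h : ∀ i ∈ Z, M i ≤ N) (q : ℕ) :
    (if hq : q < (Z.sort (· ≤ ·)).length then M ((Z.sort (· ≤ ·))[q]) else 0) ≤ N := by
  split_ifs with hq
  · exact h _ (sort_getElem_mem Z q hq)
  · exact Nat.zero_le _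

/-- Transport of an `∃ i ∈ Z` witness to a position in the first block. [plumbing] -/
theorem pos_exists_of_exists (P : Fin n → Prop) (h : ∃ i ∈ Z, P i) (L : ℕ) (hL : (Z.sort (· ≤ ·)).length ≤ L) :
    ∃ q : Fin L, ∃ hq : (q : ℕ) < (Z.sort (· ≤ ·)).length, P ((Z.sort (· ≤ ·))[(q : ℕ)]) := by
  obtain ⟨i, hi, hP⟩ := h
  obtain ⟨q, hq, hqi⟩ := List.getElem_of_mem ((Finset.mem_sort (· ≤ ·)).mpr hi)
  exact ⟨⟨q, lt_of_lt_of_le hq hL⟩, hq, by rw [hqi]; exact hP⟩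

/-! ## §2 The regular systems of parameters adapted to the orbit -/

variable (hφθ : φ θ = 0) [IsNoetherianRing B]

include hφθ hφ in
/-- ★ r.s.o.p. `Zl.map z ++ t` from an Ishii letter `l ∉ Z`. [cite: Matsumura1987, Thm. 14.2] -/
theorem exists_rsop_orbit (hθ : eval c θ = 0) (l : Fin n) (hlZ : l ∉ Z) (hl : eval c (pderiv l θ) ≠ 0) (z : Fin n → B) (hz : ∀ i, z i = φ (X i - C (c i))) :
    ∃ t : List B, Ideal.ofList ((Z.sort (· ≤ ·)).map z ++ t) = maximalIdeal B ∧ ((Z.sort (· ≤ ·)).map z ++ t).length = n - 1 := by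
  classical
  set R : List (Fin n) := ((List.finRange n).erase l).filter (fun i => i ∉ Z) with hR
  have hnd : ((List.finRange n).erase l).Nodup := (List.nodup_finRange n).erase l
  have hperm : ((List.finRange n).erase l).Perm (Z.sort (· ≤ ·) ++ R) := by
    refine (List.perm_ext_iff_of_nodup hnd ?_).mpr fun i => ?_
    · refine List.nodup_append.mpr ⟨Finset.sort_nodup _ _, hnd.filter _, fun i hi j hj => ?_⟩
      rintro rfl
      rw [hR, List.mem_filter] at hj
      exact (of_decide_eq_true hj.2) ((Finset.mem_sort _).mp hi)
    · rw [List.mem_append, Finset.mem_sort, hR, List.mem_filter, List.Nodup.mem_erase_iff (List.nodup_finRange n)]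
      simp only [ne_eq, List.mem_finRange, and_true, decide_eq_true_eq]
      constructor
      · intro hil
        by_cases hi : i ∈ Z
        · exact Or.inl hi
        · exact Or.inr ⟨hil, hi⟩
      · rintro (hi | ⟨hil, -⟩)
        · rintro rfl; exact hlZ hi
        · exact hil
  refine ⟨R.map z, ?_, ?_⟩
  · rw [← List.map_append, ← ofList_eq_of_perm (hperm.map z)]
    exact ofList_erase_eq_maximalIdeal θ c φ hφθ hφ hθ l hl z hz
  · rw [← List.map_append, List.length_map, ← hperm.length_eq, List.length_erase_of_mem (List.mem_finRange l), List.length_finRange]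

include hφθ hφ in
/-- ★ r.s.o.p. `Zl.map z ++ (φ w :: t)` from a nonzero `2×2` minor over `l, i₀ ∉ Z` (`w(c) = 0`). [cite: Matsumura1987, Thm. 14.2] -/
theorem exists_rsop_orbit_cons (hθ : eval c θ = 0) (l : Fin n) (hlZ : l ∉ Z) (hl : eval c (pderiv l θ) ≠ 0) (w : MvPolynomial (Fin n) k) (hw : eval c w = 0)
    (i₀ : Fin n) (hi₀Z : i₀ ∉ Z) (hi₀ : i₀ ≠ l) (hminor : eval c (pderiv l θ) * eval c (pderiv i₀ w) - eval c (pderiv i₀ θ) * eval c (pderiv l w) ≠ 0)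
    (z : Fin n → B) (hz : ∀ i, z i = φ (X i - C (c i))) :
    ∃ t : List B, Ideal.ofList ((Z.sort (· ≤ ·)).map z ++ (φ w :: t)) = maximalIdeal B ∧ ((Z.sort (· ≤ ·)).map z ++ (φ w :: t)).length = n - 1 := by
  classical
  set R : List (Fin n) := (((List.finRange n).erase l).erase i₀).filter (fun i => i ∉ Z) with hR
  have hnd1 : ((List.finRange n).erase l).Nodup := (List.nodup_finRange n).erase l
  have hnd : (((List.finRange n).erase l).erase i₀).Nodup := hnd1.erase i₀
  have hperm : (((List.finRange n).erase l).erase i₀).Perm (Z.sort (· ≤ ·) ++ R) := by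
    refine (List.perm_ext_iff_of_nodup hnd ?_).mpr fun i => ?_
    · refine List.nodup_append.mpr ⟨Finset.sort_nodup _ _, hnd.filter _, fun i hi j hj => ?_⟩
      rintro rfl
      rw [hR, List.mem_filter] at hj
      exact (of_decide_eq_true hj.2) ((Finset.mem_sort _).mp hi)
    · rw [List.mem_append, Finset.mem_sort, hR, List.mem_filter, List.Nodup.mem_erase_iff hnd1, List.Nodup.mem_erase_iff (List.nodup_finRange n)]
      simp only [ne_eq, List.mem_finRange, and_true, decide_eq_true_eq]
      constructor
      · rintro ⟨hii₀, hil⟩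
        by_cases hi : i ∈ Z
        · exact Or.inl hi
        · exact Or.inr ⟨⟨hii₀, hil⟩, hi⟩
      · rintro (hi | ⟨h, -⟩)
        · exact ⟨by rintro rfl; exact hi₀Z hi, by rintro rfl; exact hlZ hi⟩
        · exact h
  have hi₀mem : i₀ ∈ (List.finRange n).erase l := (List.Nodup.mem_erase_iff (List.nodup_finRange n)).mpr ⟨hi₀, List.mem_finRange i₀⟩
  have hn : 2 ≤ n := by
    have h1 : ((List.finRange n).erase l).length = n - 1 := by rw [List.length_erase_of_mem (List.mem_finRange l), List.length_finRange]
    have h2 : 0 < ((List.finRange n).erase l).length := List.length_pos_of_mem hi₀mem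
    omega
  refine ⟨R.map z, ?_, ?_⟩
  · have hp : (φ w :: (((List.finRange n).erase l).erase i₀).map z).Perm ((Z.sort (· ≤ ·)).map z ++ (φ w :: R.map z)) := by
      refine (List.Perm.cons (φ w) (hperm.map z)).trans ?_
      rw [List.map_append]
      exact List.perm_middle.symm
    rw [← ofList_eq_of_perm hp]
    exact ofList_swap_eq_maximalIdeal θ c φ hφθ hφ hθ l hl w hw i₀ hi₀ hminor z hz
  · rw [List.length_append, List.length_cons, List.length_map, List.length_map]
    have := hperm.length_eq
    rw [List.length_append, List.length_erase_of_mem hi₀mem, List.length_erase_of_mem (List.mem_finRange l), List.length_finRange] at this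
    omega


end Summit.ResolutionOfSingularities.ResolutionOfSingularities.Theorems.FInjectiveMacaulayfication.ChartPointSoundness

/-! ## §3 ★★★ Soundness of the exit tags at a point -/

namespace Summit.ResolutionOfSingularities.ResolutionOfSingularities.Theorems.FInjectiveMacaulayfication.ChartPointSoundness

open IsLocalRing MvPolynomial Literature.RingTheory.TightClosure Literature.AlgebraicGeometry.Resolution
open Summit.ResolutionOfSingularities.ResolutionOfSingularities.Theorems.FInjectiveMacaulayfication SliceableCentre ChartPointParameters RsopPositionMonomials

set_option maxHeartbeats 400000 in
/-- ★★★ **SOUNDNESS OF THE EXIT TAGS AT A POINT OF A CHART.** See the module docstring. [OURS · F6 v2 per-point dispatcher; cite: Fedder1983, Thm. 1.12; Matsumura1987, Thm. 17.4] -/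
theorem tag_soundness {k : Type} [Field k] {n : ℕ} (θ : MvPolynomial (Fin n) k) (c : Fin n → k)
    {B : Type} [CommRing B] [IsRegularLocalRing B] (p : ℕ) [Fact p.Prime] [CharP B p] [IsAlgClosed (ResidueField B)]
    (φ : MvPolynomial (Fin n) k →+* B) (hφθ : φ θ = 0)
    (hφ : (Ideal.span (Set.range fun i : Fin n => (X i : MvPolynomial (Fin n) k) - C (c i))).map φ = maximalIdeal B)
    (Z : Finset (Fin n)) (hZ : ∀ i, c i = 0 ↔ i ∈ Z)
    (hdim : ringKrullDim B = ((n - 1 : ℕ) : WithBot ℕ∞)) (hθ : eval c θ = 0)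
    (M1 M2 r sx : Fin n →₀ ℕ) (hM : ∀ i, M1 i = 0 ∨ M2 i = 0) (hrs : ∀ i, r i = 0 ∨ sx i = 0) (ha : ∃ i ∈ Z, M1 i ≠ 0)
    (u v : B) (hu : u = φ (monomial M1 1)) (hv : v = φ (monomial M2 1 * (monomial r 1 - monomial sx 1)))
    (hl : ∃ l, l ∉ Z ∧ eval c (pderiv l θ) ≠ 0)
    (hminor : (∀ i ∈ Z, r i = 0) → (∀ i ∈ Z, sx i = 0) → eval c (monomial r (1 : k) - monomial sx 1) = 0 →
      ∃ l i₀, l ∉ Z ∧ i₀ ∉ Z ∧ l ≠ i₀ ∧ eval c (pderiv l θ) ≠ 0 ∧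
        eval c (pderiv l θ) * eval c (pderiv i₀ (monomial r (1 : k) - monomial sx 1)) - eval c (pderiv i₀ θ) * eval c (pderiv l (monomial r (1 : k) - monomial sx 1)) ≠ 0)
    (htag : (¬ ((∃ i ∈ Z, r i ≠ 0) ∧ (∃ i ∈ Z, sx i ≠ 0)) ∧
        ((∀ i ∈ Z, M2 i ≤ 1) ∨ (∀ i ∈ Z, M1 i ≤ 1) ∨ ((∀ i ∈ Z, M1 i ≤ 2) ∧ (∀ i ∈ Z, M2 i ≤ 2) ∧ p ≠ 2))) ∨
      (((∃ i ∈ Z, r i ≠ 0) ∧ (∃ i ∈ Z, sx i ≠ 0)) ∧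
        (((∀ i ∈ Z, M1 i ≤ 1) ∧ (∃ i ∈ Z, M2 i + r i ≠ 0 ∧ M1 i = 0) ∧ (∃ i ∈ Z, M2 i + sx i ≠ 0 ∧ M1 i = 0)) ∨
          ((∀ i ∈ Z, M2 i + r i ≤ 1) ∧ (∃ i ∈ Z, M1 i ≠ 0 ∧ r i = 0))))) :
    IsUnit v ∨
      (u ∈ nonZeroDivisors B ∧ (∀ t : B, u ∣ t * v → u ∣ t) ∧ v ∈ nonZeroDivisors B ∧ (∀ t : B, v ∣ t * u → v ∣ t) ∧
        (∀ (Q : Ideal ((Polynomial B) ⧸ Ideal.span {Polynomial.C u * Polynomial.X - Polynomial.C v})) [Q.IsPrime],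
          (Q.comap (Ideal.Quotient.mk (Ideal.span {Polynomial.C u * Polynomial.X - Polynomial.C v}))).comap (Polynomial.C : B →+* Polynomial B) = maximalIdeal B →
            FullCl p (Localization.AtPrime Q)) ∧
        (∀ (Q : Ideal ((Polynomial B) ⧸ Ideal.span {Polynomial.C v * Polynomial.X - Polynomial.C u})) [Q.IsPrime],
          (Q.comap (Ideal.Quotient.mk (Ideal.span {Polynomial.C v * Polynomial.X - Polynomial.C u}))).comap (Polynomial.C : B →+* Polynomial B) = maximalIdeal B →
            FullCl p (Localization.AtPrime Q))) := by
  classical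
  -- notation
  have hZlnd : (Z.sort (· ≤ ·)).Nodup := Finset.sort_nodup _ _
  set z : Fin n → B := fun i => φ (X i - C (c i)) with hzdef
  have hz : ∀ i, z i = φ (X i - C (c i)) := fun i => rfl
  set w : MvPolynomial (Fin n) k := monomial r (1 : k) - monomial sx 1 with hw
  obtain ⟨l, hlZ, hl⟩ := hl
  -- the unit factors
  have hU : ∀ E : Fin n →₀ ℕ, IsUnit (∏ i ∈ Zᶜ, φ (X i) ^ E i) := fun E => isUnit_prod_compl c φ hφ Z hZ E
  have hsplit : ∀ E : Fin n →₀ ℕ, φ (monomial E (1 : k)) = (∏ i ∈ Zᶜ, φ (X i) ^ E i) * ∏ i ∈ (Z.sort (· ≤ ·)).toFinset, z i ^ E i := fun E => by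
    rw [map_monomial_eq_prod, prod_eq_prod_sort_mul c φ Z hZ E z hz, mul_comm]
  -- position exponents
  obtain ⟨a, ha_def⟩ : ∃ a : ℕ → ℕ, a = fun q => if h : q < (Z.sort (· ≤ ·)).length then M1 ((Z.sort (· ≤ ·))[q]) else 0 := ⟨_, rfl⟩
  obtain ⟨m, hm_def⟩ : ∃ m : ℕ → ℕ, m = fun q => if h : q < (Z.sort (· ≤ ·)).length then M2 ((Z.sort (· ≤ ·))[q]) else 0 := ⟨_, rfl⟩
  obtain ⟨b, hb_def⟩ : ∃ b : ℕ → ℕ, b = fun q => if h : q < (Z.sort (· ≤ ·)).length then r ((Z.sort (· ≤ ·))[q]) else 0 := ⟨_, rfl⟩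
  obtain ⟨cc, hcc_def⟩ : ∃ cc : ℕ → ℕ, cc = fun q => if h : q < (Z.sort (· ≤ ·)).length then sx ((Z.sort (· ≤ ·))[q]) else 0 := ⟨_, rfl⟩
  have hdisj : ∀ q : ℕ, a q = 0 ∨ m q = 0 := fun q => by
    by_cases hq : q < (Z.sort (· ≤ ·)).length
    · simp only [ha_def, hm_def, dif_pos hq]; exact hM _
    · left; rw [ha_def]; exact dif_neg hq
  have hbc : ∀ q : ℕ, b q = 0 ∨ cc q = 0 := fun q => by
    by_cases hq : q < (Z.sort (· ≤ ·)).length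
    · simp only [hb_def, hcc_def, dif_pos hq]; exact hrs _
    · left; rw [hb_def]; exact dif_neg hq
  -- vanishing of monomials at `c`
  have hev : ∀ E : Fin n →₀ ℕ, eval c (monomial E (1 : k)) = 0 ↔ ∃ i ∈ Z, E i ≠ 0 := fun E => eval_monomial_eq_zero_iff c Z hZ E
  by_cases hwc : eval c w = 0
  swap
  · ----------------------------------------------------------------
    -- `w(c) ≠ 0`: `φ w` is a unit; principal unless `M₂|Z ≠ 0`
    have hwu : IsUnit (φ w) := isUnit_map_of_eval_ne_zero c φ hφ w hwc
    have hnd : ¬ ((∃ i ∈ Z, r i ≠ 0) ∧ (∃ i ∈ Z, sx i ≠ 0)) := fun ⟨h1, h2⟩ => hwc (by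
      rw [hw, map_sub, (hev r).mpr h1, (hev sx).mpr h2, sub_self])
    rcases htag with ⟨-, hcode⟩ | ⟨hdeep, -⟩
    swap
    · exact absurd hdeep hnd
    by_cases hM2Z : ∀ i ∈ Z, M2 i = 0
    · left
      rw [hv, map_mul, hsplit M2]
      have h1 : (∏ i ∈ (Z.sort (· ≤ ·)).toFinset, z i ^ M2 i) = 1 := Finset.prod_eq_one fun i hi => by
        rw [hM2Z i (by rw [Finset.sort_toFinset] at hi; exact hi), pow_zero]
      rw [h1, mul_one]
      exact (hU M2).mul hwu
    · right
      push Not at hM2Z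
      obtain ⟨t, hspan, hlen⟩ := exists_rsop_orbit θ c φ hφ Z hφθ hθ l hlZ hl z hz
      set s : List B := (Z.sort (· ≤ ·)).map z ++ t with hs
      have hlen' : (s.length : WithBot ℕ∞) = ringKrullDim B := by rw [hlen, hdim]
      have hZs : (Z.sort (· ≤ ·)).length ≤ s.length := by rw [hs, List.length_append, List.length_map]; omega
      have hmono_a : (∏ q : Fin s.length, s[q] ^ a q) = ∏ i ∈ (Z.sort (· ≤ ·)).toFinset, z i ^ M1 i := by rw [ha_def]; exact prod_getElem_pow_append_eq (Z.sort (· ≤ ·)) hZlnd z t M1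
      have hmono_m : (∏ q : Fin s.length, s[q] ^ m q) = ∏ i ∈ (Z.sort (· ≤ ·)).toFinset, z i ^ M2 i := by rw [hm_def]; exact prod_getElem_pow_append_eq (Z.sort (· ≤ ·)) hZlnd z t M2
      have hu' : u = (∏ i ∈ Zᶜ, φ (X i) ^ M1 i) * ∏ q : Fin s.length, s[q] ^ a q := by rw [hmono_a, hu, hsplit M1]
      have hv' : v = ((∏ i ∈ Zᶜ, φ (X i) ^ M2 i) * φ w) * ∏ q : Fin s.length, s[q] ^ m q := by rw [hmono_m, hv, map_mul, hsplit M2]; ring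
      have ha' : ∃ q : Fin s.length, a q ≠ 0 := by
        obtain ⟨q, hq, hP⟩ := pos_exists_of_exists Z (fun i => M1 i ≠ 0) ha s.length hZs
        exact ⟨q, by simp only [ha_def, dif_pos hq]; exact hP⟩
      have hm' : ∃ q : Fin s.length, m q ≠ 0 := by
        obtain ⟨q, hq, hP⟩ := pos_exists_of_exists Z (fun i => M2 i ≠ 0) hM2Z s.length hZs
        exact ⟨q, by simp only [hm_def, dif_pos hq]; exact hP⟩
      have hcode' : (∀ q, m q ≤ 1) ∨ (∀ q, a q ≤ 1) ∨ ((∀ q, a q ≤ 2) ∧ (∀ q, m q ≤ 2) ∧ p ≠ 2) := by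
        rcases hcode with h1 | h2 | ⟨h3, h4, hp⟩
        · exact Or.inl fun q => by rw [hm_def]; exact pos_le_of_forall Z M2 1 h1 q
        · exact Or.inr (Or.inl fun q => by rw [ha_def]; exact pos_le_of_forall Z M1 1 h2 q)
        · exact Or.inr (Or.inr ⟨fun q => by rw [ha_def]; exact pos_le_of_forall Z M1 2 h3 q, fun q => by rw [hm_def]; exact pos_le_of_forall Z M2 2 h4 q, hp⟩)
      exact PencilPointRecipes.recipe_two_monomials p s hspan hlen' a m hdisj ha' hm' _ _ (hU M1) ((hU M2).mul hwu) u v hu' hv' hcode'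
  · ----------------------------------------------------------------
    -- `w(c) = 0`
    right
    rcases htag with ⟨hnd, hcode⟩ | ⟨⟨hrZ, hsZ⟩, hcode45⟩
    · -- T1: both monomials of `w` are orbit-free
      have key : (∃ i ∈ Z, r i ≠ 0) ↔ (∃ i ∈ Z, sx i ≠ 0) := by
        rw [← hev r, ← hev sx]
        rw [hw, map_sub, sub_eq_zero] at hwc
        rw [hwc]
      have hr0 : ∀ i ∈ Z, r i = 0 := fun i hi => by
        by_contra h; exact hnd ⟨⟨i, hi, h⟩, key.mp ⟨i, hi, h⟩⟩
      have hs0 : ∀ i ∈ Z, sx i = 0 := fun i hi => by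
        by_contra h; exact hnd ⟨key.mpr ⟨i, hi, h⟩, ⟨i, hi, h⟩⟩
      obtain ⟨l', i₀, hl'Z, hi₀Z, hne, hl', hmin⟩ := hminor hr0 hs0 hwc
      obtain ⟨t, hspan, hlen⟩ := exists_rsop_orbit_cons θ c φ hφ Z hφθ hθ l' hl'Z hl' w hwc i₀ hi₀Z (Ne.symm hne) hmin z hz
      set s : List B := (Z.sort (· ≤ ·)).map z ++ (φ w :: t) with hs
      have hlen' : (s.length : WithBot ℕ∞) = ringKrullDim B := by rw [hlen, hdim]
      have hZs : (Z.sort (· ≤ ·)).length < s.length := by rw [hs, List.length_append, List.length_map, List.length_cons]; omega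
      obtain ⟨m', hm'_def⟩ : ∃ m' : ℕ → ℕ, m' = fun q => (if h : q < (Z.sort (· ≤ ·)).length then M2 ((Z.sort (· ≤ ·))[q]) else 0) + (if q = (Z.sort (· ≤ ·)).length then 1 else 0) := ⟨_, rfl⟩
      have hmono_a : (∏ q : Fin s.length, s[q] ^ a q) = ∏ i ∈ (Z.sort (· ≤ ·)).toFinset, z i ^ M1 i := by rw [ha_def]; exact prod_getElem_pow_append_eq (Z.sort (· ≤ ·)) hZlnd z (φ w :: t) M1
      have hmono_m : (∏ q : Fin s.length, s[q] ^ m' q) = (∏ i ∈ (Z.sort (· ≤ ·)).toFinset, z i ^ M2 i) * φ w := by rw [hm'_def]; exact prod_getElem_pow_append_cons_eq (Z.sort (· ≤ ·)) hZlnd z (φ w) t M2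
      have hu' : u = (∏ i ∈ Zᶜ, φ (X i) ^ M1 i) * ∏ q : Fin s.length, s[q] ^ a q := by rw [hmono_a, hu, hsplit M1]
      have hv' : v = (∏ i ∈ Zᶜ, φ (X i) ^ M2 i) * ∏ q : Fin s.length, s[q] ^ m' q := by rw [hmono_m, hv, map_mul, hsplit M2]; ring
      have hdisj' : ∀ q : ℕ, a q = 0 ∨ m' q = 0 := fun q => by
        by_cases hq : q < (Z.sort (· ≤ ·)).length
        · have hne' : q ≠ (Z.sort (· ≤ ·)).length := by omega
          simp only [ha_def, hm'_def, dif_pos hq, if_neg hne', add_zero]; exact hM _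
        · left; rw [ha_def]; exact dif_neg hq
      have ha' : ∃ q : Fin s.length, a q ≠ 0 := by
        obtain ⟨q, hq, hP⟩ := pos_exists_of_exists Z (fun i => M1 i ≠ 0) ha s.length hZs.le
        exact ⟨q, by simp only [ha_def, dif_pos hq]; exact hP⟩
      have hm'' : ∃ q : Fin s.length, m' q ≠ 0 := ⟨⟨(Z.sort (· ≤ ·)).length, hZs⟩, by simp [hm'_def]⟩
      have hm'le : ∀ N : ℕ, 1 ≤ N → (∀ i ∈ Z, M2 i ≤ N) → ∀ q, m' q ≤ N := fun N hN h q => by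
        by_cases hq : q < (Z.sort (· ≤ ·)).length
        · have hne' : q ≠ (Z.sort (· ≤ ·)).length := by omega
          simp only [hm'_def, dif_pos hq, if_neg hne', add_zero]; exact h _ (sort_getElem_mem Z q hq)
        · by_cases hq' : q = (Z.sort (· ≤ ·)).length
          · simp only [hm'_def, dif_neg hq, if_pos hq', zero_add]; exact hN
          · simp only [hm'_def, dif_neg hq, if_neg hq', add_zero]; exact Nat.zero_le _
      have hcode' : (∀ q, m' q ≤ 1) ∨ (∀ q, a q ≤ 1) ∨ ((∀ q, a q ≤ 2) ∧ (∀ q, m' q ≤ 2) ∧ p ≠ 2) := by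
        rcases hcode with h1 | h2 | ⟨h3, h4, hp⟩
        · exact Or.inl (hm'le 1 le_rfl h1)
        · exact Or.inr (Or.inl fun q => by rw [ha_def]; exact pos_le_of_forall Z M1 1 h2 q)
        · exact Or.inr (Or.inr ⟨fun q => by rw [ha_def]; exact pos_le_of_forall Z M1 2 h3 q, hm'le 2 (by norm_num) h4, hp⟩)
      exact PencilPointRecipes.recipe_two_monomials p s hspan hlen' a m' hdisj' ha' hm'' _ _ (hU M1) (hU M2) u v hu' hv' hcode'
    · -- deep
      obtain ⟨t, hspan, hlen⟩ := exists_rsop_orbit θ c φ hφ Z hφθ hθ l hlZ hl z hz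
      set s : List B := (Z.sort (· ≤ ·)).map z ++ t with hs
      have hlen' : (s.length : WithBot ℕ∞) = ringKrullDim B := by rw [hlen, hdim]
      have hZs : (Z.sort (· ≤ ·)).length ≤ s.length := by rw [hs, List.length_append, List.length_map]; omega
      have hmono : ∀ E : Fin n →₀ ℕ, (∏ q : Fin s.length, s[q] ^ (if h : (q : ℕ) < (Z.sort (· ≤ ·)).length then E ((Z.sort (· ≤ ·))[(q : ℕ)]) else 0)) = ∏ i ∈ (Z.sort (· ≤ ·)).toFinset, z i ^ E i :=
        fun E => prod_getElem_pow_append_eq (Z.sort (· ≤ ·)) hZlnd z t E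
      have hu' : u = (∏ i ∈ Zᶜ, φ (X i) ^ M1 i) * ∏ q : Fin s.length, s[q] ^ a q := by rw [ha_def, hmono M1, hu, hsplit M1]
      have hv' : v = (∏ i ∈ Zᶜ, φ (X i) ^ M2 i) * (∏ q : Fin s.length, s[q] ^ m q) *
          ((∏ i ∈ Zᶜ, φ (X i) ^ r i) * (∏ q : Fin s.length, s[q] ^ b q) - (∏ i ∈ Zᶜ, φ (X i) ^ sx i) * (∏ q : Fin s.length, s[q] ^ cc q)) := by
        rw [hm_def, hb_def, hcc_def, hmono M2, hmono r, hmono sx, hv, map_mul, map_sub, hsplit M2, hsplit r, hsplit sx]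
      have ha' : ∃ q : Fin s.length, a q ≠ 0 := by
        obtain ⟨q, hq, hP⟩ := pos_exists_of_exists Z (fun i => M1 i ≠ 0) ha s.length hZs
        exact ⟨q, by simp only [ha_def, dif_pos hq]; exact hP⟩
      have hb' : ∃ q : Fin s.length, b q ≠ 0 := by
        obtain ⟨q, hq, hP⟩ := pos_exists_of_exists Z (fun i => r i ≠ 0) hrZ s.length hZs
        exact ⟨q, by simp only [hb_def, dif_pos hq]; exact hP⟩
      have hc' : ∃ q : Fin s.length, cc q ≠ 0 := by
        obtain ⟨q, hq, hP⟩ := pos_exists_of_exists Z (fun i => sx i ≠ 0) hsZ s.length hZs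
        exact ⟨q, by simp only [hcc_def, dif_pos hq]; exact hP⟩
      have hcode' : ((∀ q, a q ≤ 1) ∧ (∃ q : Fin s.length, m q + b q ≠ 0 ∧ a q = 0) ∧ (∃ q : Fin s.length, m q + cc q ≠ 0 ∧ a q = 0)) ∨
          ((∀ q, m q + b q ≤ 1) ∧ (∃ q₀ : Fin s.length, a q₀ ≠ 0 ∧ b q₀ = 0)) := by
        rcases hcode45 with ⟨h1, h2, h3⟩ | ⟨h4, h5⟩
        · refine Or.inl ⟨fun q => by rw [ha_def]; exact pos_le_of_forall Z M1 1 h1 q, ?_, ?_⟩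
          · obtain ⟨q, hq, hP⟩ := pos_exists_of_exists Z (fun i => M2 i + r i ≠ 0 ∧ M1 i = 0) h2 s.length hZs
            exact ⟨q, by simp only [hm_def, hb_def, ha_def, dif_pos hq]; exact hP⟩
          · obtain ⟨q, hq, hP⟩ := pos_exists_of_exists Z (fun i => M2 i + sx i ≠ 0 ∧ M1 i = 0) h3 s.length hZs
            exact ⟨q, by simp only [hm_def, hcc_def, ha_def, dif_pos hq]; exact hP⟩
        · refine Or.inr ⟨fun q => ?_, ?_⟩
          · by_cases hq : q < (Z.sort (· ≤ ·)).length
            · simp only [hm_def, hb_def, dif_pos hq]; exact h4 _ (sort_getElem_mem Z q hq)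
            · simp only [hm_def, hb_def, dif_neg hq]; exact Nat.zero_le _
          · obtain ⟨q, hq, hP⟩ := pos_exists_of_exists Z (fun i => M1 i ≠ 0 ∧ r i = 0) h5 s.length hZs
            exact ⟨q, by simp only [ha_def, hb_def, dif_pos hq]; exact hP⟩
      exact PencilPointRecipes.recipe_deep p s hspan hlen' a m b cc hdisj hbc ha' hb' hc' _ _ _ _ (hU M1) (hU M2) (hU r) (hU sx) u v hu' hv' hcode'

end Summit.ResolutionOfSingularities.ResolutionOfSingularities.Theorems.FInjectiveMacaulayfication.ChartPointSoundness

end
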